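import Mathlib
import Literature.Analysis.FluidPDE.CompressibleEulerImplosionComplexField
import Literature.Analysis.ValidatedNumerics.TaylorModelComplexEval
import HarnessLib

/-!
# Buckmaster–Cao-Labora–Gómez-Serrano at `γ = 5/3`, complex time: the disc-certificate FORMAT (defect and range bounds of a
# Taylor-model polynomial candidate, kernel-checkable)

The certified analytic continuation of the smooth profile into a complex disc `|t| ≤ R` of time around a real (or complex) centre
uses the a-posteriori theorem `Literature.Analysis.ODE.exists_holomorphic_solution_in_tube`: one needs a holomorphic CANDIDATE `ŷ`
with a DEFECT bound `‖ŷ′ − F(ŷ)‖ ≤ δ` and RANGE bounds (`sup |ŷᵢ|`, `inf |Dᵢ ∘ ŷ|`) on the disc, UNIFORMLY in the speed parameter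
`r = r_m + ρ`, `|ρ| ≤ h`. Here the candidate is a pair of polynomials in `t` whose coefficients are functions of `ρ` enclosed by Taylor
models (`TPoly`, `TPMem` of `ValidatedNumerics.TaylorModelPoly`): `ŷ₁(t) = Σ a_k(ρ) tᵏ`, `ŷ₂(t) = Σ b_k(ρ) tᵏ`. This file is the
FORMAT: it defines, on the function side and on the Taylor-model side in parallel, the coefficient lists of `D_W∘ŷ`, `D_Z∘ŷ`,
`N_W∘ŷ`, `N_Z∘ŷ` and of the defects `E_W = (D_W∘ŷ)·ŷ₁′ − N_W∘ŷ`, `E_Z`, proves the enclosures (`tpmem_*`), the complex-evaluation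
identities (`evalC_DWfs`, …, `evalC_EWfs`), and the SOUNDNESS statements that turn four kernel-computed integers into the real
inequalities the disc theorem consumes: `norm_defect_le` (the field-form defect `max_i |E_i|/|D_i| ≤ max_i B_i·R_d/L_i`, scale-free),
`range_bounds` (`|ŷ₁| ≤ M_W`, `|ŷ₂| ≤ M_Z`, `|D_W∘ŷ| ≥ L_W/(R_d S)`, `|D_Z∘ŷ| ≥ L_Z/(R_d S)` on the disc). Together with
`…ComplexField` (`tubeSet`, `lipschitz_cfield`, or its structured refinement) this is everything a per-disc data file has to
instantiate (by `decide`). No facts.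
[cite: BuckmasterCaolaboraGomezserrano2025, §1.3 eq. (1.8); Moore1966, Theorem 3.1]
-/

noncomputable section

open Set Metric

namespace Literature.Analysis.FluidPDE

namespace BuckmasterCaolaboraGomezserrano2025

namespace Monatomic

namespace ComplexDisc

open Literature.Analysis.ValidatedNumerics Literature.Analysis.ValidatedNumerics.PolyMP
open Literature.Analysis.ValidatedNumerics.NumericsMP

/-! ### The candidate and the composed coefficient lists (function side) -/

/-- Negation of a list of coefficient functions. [folklore] -/
def negL (fs : List (ℝ → ℝ)) : List (ℝ → ℝ) := fs.map fun f ρ => -f ρ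

/-- Constant coefficient function. [folklore] -/
def cstF (q : ℚ) : ℝ → ℝ := fun _ => (q : ℝ)

/-- The candidate component `t ↦ Σ fₖ(ρ) tᵏ`. [folklore] -/
def candC (fs : List (ℝ → ℝ)) (ρ : ℝ) (t : ℂ) : ℂ := evalC (evalAt ρ fs) t

/-- Coefficient functions of `D_W ∘ ŷ = 1 + (2 ŷ₁ + ŷ₂)/3`. [cite: BuckmasterCaolaboraGomezserrano2025, §1.3 eq. (1.8)] -/
def DWfs (aW aZ : List (ℝ → ℝ)) : List (ℝ → ℝ) :=
  addL [cstF 1] (smulL (cstF (1 / 3)) (addL (smulL (cstF 2) aW) aZ))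

/-- Coefficient functions of `D_Z ∘ ŷ = 1 + (ŷ₁ + 2 ŷ₂)/3`. [cite: BuckmasterCaolaboraGomezserrano2025, §1.3 eq. (1.8)] -/
def DZfs (aW aZ : List (ℝ → ℝ)) : List (ℝ → ℝ) :=
  addL [cstF 1] (smulL (cstF (1 / 3)) (addL aW (smulL (cstF 2) aZ)))

/-- Coefficient functions of `N_W ∘ ŷ = −r ŷ₁ − (5/6)ŷ₁² − (1/3)ŷ₁ŷ₂ + (1/6)ŷ₂²` (`r = rF ρ`).
[cite: BuckmasterCaolaboraGomezserrano2025, §1.3 eq. (1.8)] -/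
def NWfs (rF : ℝ → ℝ) (aW aZ : List (ℝ → ℝ)) : List (ℝ → ℝ) :=
  addL (addL (negL (smulL rF aW)) (negL (smulL (cstF (5 / 6)) (mulL aW aW))))
    (addL (negL (smulL (cstF (1 / 3)) (mulL aW aZ))) (smulL (cstF (1 / 6)) (mulL aZ aZ)))

/-- Coefficient functions of `N_Z ∘ ŷ = −r ŷ₂ − (1/3)ŷ₁ŷ₂ − (5/6)ŷ₂² + (1/6)ŷ₁²`.
[cite: BuckmasterCaolaboraGomezserrano2025, §1.3 eq. (1.8)] -/
def NZfs (rF : ℝ → ℝ) (aW aZ : List (ℝ → ℝ)) : List (ℝ → ℝ) :=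
  addL (addL (negL (smulL rF aZ)) (negL (smulL (cstF (1 / 3)) (mulL aW aZ))))
    (addL (negL (smulL (cstF (5 / 6)) (mulL aZ aZ))) (smulL (cstF (1 / 6)) (mulL aW aW)))

/-- Coefficient functions of the defect `E_W = (D_W∘ŷ)·ŷ₁′ − N_W∘ŷ`. [folklore] -/
def EWfs (rF : ℝ → ℝ) (aW aZ : List (ℝ → ℝ)) : List (ℝ → ℝ) :=
  addL (mulL (DWfs aW aZ) (derL aW)) (negL (NWfs rF aW aZ))

/-- Coefficient functions of the defect `E_Z = (D_Z∘ŷ)·ŷ₂′ − N_Z∘ŷ`. [folklore] -/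
def EZfs (rF : ℝ → ℝ) (aW aZ : List (ℝ → ℝ)) : List (ℝ → ℝ) :=
  addL (mulL (DZfs aW aZ) (derL aZ)) (negL (NZfs rF aW aZ))

/-! ### The same on the Taylor-model side -/

/-- Taylor models of `D_W ∘ ŷ`. [folklore] -/
def DWP (S : ℕ) (h : ℚ) (D : ℕ) (AW AZ : TPoly) : TPoly :=
  tpadd (tpconst S 1) (tpsmul S h D (tconst (ofRat S (1 / 3))) (tpadd (tpsmul S h D (tconst (ofRat S 2)) AW) AZ))

/-- Taylor models of `D_Z ∘ ŷ`. [folklore] -/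
def DZP (S : ℕ) (h : ℚ) (D : ℕ) (AW AZ : TPoly) : TPoly :=
  tpadd (tpconst S 1) (tpsmul S h D (tconst (ofRat S (1 / 3))) (tpadd AW (tpsmul S h D (tconst (ofRat S 2)) AZ)))

/-- Taylor models of `N_W ∘ ŷ` (`RM` the model of `r`). [folklore] -/
def NWP (S : ℕ) (h : ℚ) (D : ℕ) (RM : IPoly) (AW AZ : TPoly) : TPoly :=
  tpadd (tpadd (tpneg (tpsmul S h D RM AW)) (tpneg (tpsmul S h D (tconst (ofRat S (5 / 6))) (tpmul S h D AW AW))))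
    (tpadd (tpneg (tpsmul S h D (tconst (ofRat S (1 / 3))) (tpmul S h D AW AZ)))
      (tpsmul S h D (tconst (ofRat S (1 / 6))) (tpmul S h D AZ AZ)))

/-- Taylor models of `N_Z ∘ ŷ`. [folklore] -/
def NZP (S : ℕ) (h : ℚ) (D : ℕ) (RM : IPoly) (AW AZ : TPoly) : TPoly :=
  tpadd (tpadd (tpneg (tpsmul S h D RM AZ)) (tpneg (tpsmul S h D (tconst (ofRat S (1 / 3))) (tpmul S h D AW AZ))))
    (tpadd (tpneg (tpsmul S h D (tconst (ofRat S (5 / 6))) (tpmul S h D AZ AZ)))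
      (tpsmul S h D (tconst (ofRat S (1 / 6))) (tpmul S h D AW AW)))

/-- Taylor models of the defect `E_W`. [folklore] -/
def EWP (S : ℕ) (h : ℚ) (D : ℕ) (RM : IPoly) (AW AZ : TPoly) : TPoly :=
  tpadd (tpmul S h D (DWP S h D AW AZ) (tpder S AW)) (tpneg (NWP S h D RM AW AZ))

/-- Taylor models of the defect `E_Z`. [folklore] -/
def EZP (S : ℕ) (h : ℚ) (D : ℕ) (RM : IPoly) (AW AZ : TPoly) : TPoly :=
  tpadd (tpmul S h D (DZP S h D AW AZ) (tpder S AZ)) (tpneg (NZP S h D RM AW AZ))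

/-! ### Enclosures -/

section mem

variable {S : ℕ} {h : ℚ} {D : ℕ} {rF : ℝ → ℝ} {RM : IPoly} {aW aZ : List (ℝ → ℝ)} {AW AZ : TPoly}

/-- [folklore] -/
theorem tpmem_negL (hA : TPMem S h aW AW) : TPMem S h (negL aW) (tpneg AW) := tpmem_neg hA

/-- [folklore] -/
theorem tmem_cstF (S : ℕ) (h : ℚ) (q : ℚ) : TMem S h (cstF q) (tconst (ofRat S q)) :=
  tmem_const (S := S) (h := h) (mem_ofRat S q)

/-- [folklore] -/
theorem tpmem_DWP (hS : 0 < S) (h0 : 0 ≤ h) (hAW : TPMem S h aW AW) (hAZ : TPMem S h aZ AZ) :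
    TPMem S h (DWfs aW aZ) (DWP S h D AW AZ) :=
  tpmem_add (tpmem_tpconst S h 1)
    (tpmem_smul hS h0 D (tmem_cstF S h (1 / 3)) (tpmem_add (tpmem_smul hS h0 D (tmem_cstF S h 2) hAW) hAZ))

/-- [folklore] -/
theorem tpmem_DZP (hS : 0 < S) (h0 : 0 ≤ h) (hAW : TPMem S h aW AW) (hAZ : TPMem S h aZ AZ) :
    TPMem S h (DZfs aW aZ) (DZP S h D AW AZ) :=
  tpmem_add (tpmem_tpconst S h 1)
    (tpmem_smul hS h0 D (tmem_cstF S h (1 / 3)) (tpmem_add hAW (tpmem_smul hS h0 D (tmem_cstF S h 2) hAZ)))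

/-- [folklore] -/
theorem tpmem_NWP (hS : 0 < S) (h0 : 0 ≤ h) (hR : TMem S h rF RM) (hAW : TPMem S h aW AW) (hAZ : TPMem S h aZ AZ) :
    TPMem S h (NWfs rF aW aZ) (NWP S h D RM AW AZ) :=
  tpmem_add
    (tpmem_add (tpmem_neg (tpmem_smul hS h0 D hR hAW))
      (tpmem_neg (tpmem_smul hS h0 D (tmem_cstF S h (5 / 6)) (tpmem_mul hS h0 D hAW hAW))))
    (tpmem_add (tpmem_neg (tpmem_smul hS h0 D (tmem_cstF S h (1 / 3)) (tpmem_mul hS h0 D hAW hAZ)))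
      (tpmem_smul hS h0 D (tmem_cstF S h (1 / 6)) (tpmem_mul hS h0 D hAZ hAZ)))

/-- [folklore] -/
theorem tpmem_NZP (hS : 0 < S) (h0 : 0 ≤ h) (hR : TMem S h rF RM) (hAW : TPMem S h aW AW) (hAZ : TPMem S h aZ AZ) :
    TPMem S h (NZfs rF aW aZ) (NZP S h D RM AW AZ) :=
  tpmem_add
    (tpmem_add (tpmem_neg (tpmem_smul hS h0 D hR hAZ))
      (tpmem_neg (tpmem_smul hS h0 D (tmem_cstF S h (1 / 3)) (tpmem_mul hS h0 D hAW hAZ))))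
    (tpmem_add (tpmem_neg (tpmem_smul hS h0 D (tmem_cstF S h (5 / 6)) (tpmem_mul hS h0 D hAZ hAZ)))
      (tpmem_smul hS h0 D (tmem_cstF S h (1 / 6)) (tpmem_mul hS h0 D hAW hAW)))

/-- [folklore] -/
theorem tpmem_EWP (hS : 0 < S) (h0 : 0 ≤ h) (hR : TMem S h rF RM) (hAW : TPMem S h aW AW) (hAZ : TPMem S h aZ AZ) :
    TPMem S h (EWfs rF aW aZ) (EWP S h D RM AW AZ) :=
  tpmem_add (tpmem_mul hS h0 D (tpmem_DWP hS h0 hAW hAZ) (tpmem_der hAW)) (tpmem_neg (tpmem_NWP hS h0 hR hAW hAZ))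

/-- [folklore] -/
theorem tpmem_EZP (hS : 0 < S) (h0 : 0 ≤ h) (hR : TMem S h rF RM) (hAW : TPMem S h aW AW) (hAZ : TPMem S h aZ AZ) :
    TPMem S h (EZfs rF aW aZ) (EZP S h D RM AW AZ) :=
  tpmem_add (tpmem_mul hS h0 D (tpmem_DZP hS h0 hAW hAZ) (tpmem_der hAZ)) (tpmem_neg (tpmem_NZP hS h0 hR hAW hAZ))

end mem

/-! ### Complex-evaluation identities -/

section eval

variable (rF : ℝ → ℝ) (aW aZ : List (ℝ → ℝ)) (ρ : ℝ) (t : ℂ)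

/-- [folklore] -/
theorem evalC_negL (fs : List (ℝ → ℝ)) : evalC (evalAt ρ (negL fs)) t = -evalC (evalAt ρ fs) t := by
  unfold negL; rw [evalAt_map ρ Neg.neg fs, evalC_map_neg]

/-- [folklore] -/
theorem evalC_smulL (c : ℝ → ℝ) (fs : List (ℝ → ℝ)) :
    evalC (evalAt ρ (smulL c fs)) t = (c ρ : ℂ) * evalC (evalAt ρ fs) t := by
  rw [evalAt_smulL, evalC_smulR]

/-- `D_W` of the candidate. [folklore] -/
theorem evalC_DWfs : evalC (evalAt ρ (DWfs aW aZ)) t = cDW (candC aW ρ t) (candC aZ ρ t) := by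
  simp only [DWfs, candC, evalAt_addL, evalC_addR, evalC_smulL, evalAt_cons, evalAt_nil, evalC_cons, evalC_nil, cstF]
  unfold cDW; push_cast; ring

/-- `D_Z` of the candidate. [folklore] -/
theorem evalC_DZfs : evalC (evalAt ρ (DZfs aW aZ)) t = cDZ (candC aW ρ t) (candC aZ ρ t) := by
  simp only [DZfs, candC, evalAt_addL, evalC_addR, evalC_smulL, evalAt_cons, evalAt_nil, evalC_cons, evalC_nil, cstF]
  unfold cDZ; push_cast; ring

/-- `N_W` of the candidate. [folklore] -/
theorem evalC_NWfs : evalC (evalAt ρ (NWfs rF aW aZ)) t = cNW (rF ρ) (candC aW ρ t) (candC aZ ρ t) := by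
  simp only [NWfs, candC, evalAt_addL, evalC_addR, evalC_negL, evalC_smulL, evalAt_mulL, evalC_mulR, cstF]
  unfold cNW; push_cast; ring

/-- `N_Z` of the candidate. [folklore] -/
theorem evalC_NZfs : evalC (evalAt ρ (NZfs rF aW aZ)) t = cNZ (rF ρ) (candC aW ρ t) (candC aZ ρ t) := by
  simp only [NZfs, candC, evalAt_addL, evalC_addR, evalC_negL, evalC_smulL, evalAt_mulL, evalC_mulR, cstF]
  unfold cNZ; push_cast; ring

/-- The defect `E_W` of the candidate: `(D_W∘ŷ)·ŷ₁′ − N_W∘ŷ`. [folklore] -/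
theorem evalC_EWfs : evalC (evalAt ρ (EWfs rF aW aZ)) t =
    cDW (candC aW ρ t) (candC aZ ρ t) * deriv (candC aW ρ) t - cNW (rF ρ) (candC aW ρ t) (candC aZ ρ t) := by
  have hd : deriv (candC aW ρ) t = evalC (derR (evalAt ρ aW)) t := by unfold candC; exact deriv_evalC _ _
  simp only [EWfs, evalAt_addL, evalC_addR, evalAt_mulL, evalC_mulR, evalC_negL, evalAt_derL, evalC_DWfs, evalC_NWfs, hd]
  ring

/-- The defect `E_Z` of the candidate. [folklore] -/
theorem evalC_EZfs : evalC (evalAt ρ (EZfs rF aW aZ)) t =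
    cDZ (candC aW ρ t) (candC aZ ρ t) * deriv (candC aZ ρ) t - cNZ (rF ρ) (candC aW ρ t) (candC aZ ρ t) := by
  have hd : deriv (candC aZ ρ) t = evalC (derR (evalAt ρ aZ)) t := by unfold candC; exact deriv_evalC _ _
  simp only [EZfs, evalAt_addL, evalC_addR, evalAt_mulL, evalC_mulR, evalC_negL, evalAt_derL, evalC_DZfs, evalC_NZfs, hd]
  ring

end eval

/-! ### Soundness: from kernel integers to the real inequalities of the disc theorem -/

section sound

variable {S : ℕ} {h : ℚ} {D : ℕ} {rF : ℝ → ℝ} {RM : IPoly} {aW aZ : List (ℝ → ℝ)} {AW AZ : TPoly}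

/-- The candidate pair is entire, with derivative the pair of derivatives. [folklore] -/
theorem hasDerivAt_cand (aW aZ : List (ℝ → ℝ)) (ρ : ℝ) (t : ℂ) :
    HasDerivAt (fun t => ((candC aW ρ t, candC aZ ρ t) : ℂ × ℂ)) (deriv (candC aW ρ) t, deriv (candC aZ ρ) t) t := by
  have h1 : HasDerivAt (candC aW ρ) (deriv (candC aW ρ) t) t := ((differentiable_evalC _) t).hasDerivAt
  have h2 : HasDerivAt (candC aZ ρ) (deriv (candC aZ ρ) t) t := ((differentiable_evalC _) t).hasDerivAt
  exact h1.prodMk h2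

/-- [folklore] -/
theorem differentiable_cand (aW aZ : List (ℝ → ℝ)) (ρ : ℝ) :
    Differentiable ℂ (fun t => ((candC aW ρ t, candC aZ ρ t) : ℂ × ℂ)) := fun t =>
  (hasDerivAt_cand aW aZ ρ t).differentiableAt

/-- A quotient bound: `|E| ≤ B/S`, `|D| · S ≥ L/R_d > 0` give `|E/D| = |y′ − N/D| ≤ B R_d / L`. [folklore] -/
theorem norm_sub_div_le {E Dv Nv yp : ℂ} {B L : ℤ} {Rd S : ℕ} (hS : 0 < S) (hRd : 0 < Rd) (hL : 0 < L)
    (hE : ‖E‖ * S ≤ B) (hD : (L : ℝ) ≤ ‖Dv‖ * S * Rd) (hdef : E = Dv * yp - Nv) :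
    ‖yp - Nv / Dv‖ ≤ (B : ℝ) * Rd / L := by
  have hSr : (0 : ℝ) < S := by exact_mod_cast hS
  have hRr : (0 : ℝ) < Rd := by exact_mod_cast hRd
  have hLr : (0 : ℝ) < L := by exact_mod_cast hL
  have hDpos : 0 < ‖Dv‖ := by
    by_contra hc
    push Not at hc
    have : ‖Dv‖ = 0 := le_antisymm hc (norm_nonneg _)
    rw [this] at hD; simp at hD; linarith
  have hD0 : Dv ≠ 0 := norm_pos_iff.mp hDpos
  have e : yp - Nv / Dv = E / Dv := by rw [hdef]; field_simp
  rw [e, norm_div, div_le_div_iff₀ hDpos hLr]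
  -- `‖E‖ L ≤ B Rd ‖D‖`: from `‖E‖ S ≤ B` and `L ≤ ‖D‖ S Rd`
  have hB0 : 0 ≤ (B : ℝ) := le_trans (by positivity) hE
  have h1 : ‖E‖ * (‖Dv‖ * S * Rd) ≤ (B : ℝ) / S * (‖Dv‖ * S * Rd) := by
    apply mul_le_mul_of_nonneg_right _ (by positivity)
    rw [le_div_iff₀ hSr]; exact hE
  calc ‖E‖ * L ≤ ‖E‖ * (‖Dv‖ * S * Rd) := mul_le_mul_of_nonneg_left hD (norm_nonneg _)
    _ ≤ (B : ℝ) / S * (‖Dv‖ * S * Rd) := h1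
    _ = (B : ℝ) * Rd * ‖Dv‖ := by field_simp

/-- **Range bounds on the disc, uniformly in the parameter.** With `TPMem` data for the candidate, `|ρ| ≤ h`, `‖t‖ ≤ Rn/Rd`:
`‖ŷ₁(t)‖·S ≤ absBoundI(AW)`, `‖ŷ₂(t)‖·S ≤ absBoundI(AZ)`, and the lower bounds of `‖D_W(ŷ(t))‖·S`, `‖D_Z(ŷ(t))‖·S` read off the
head/tail of `DWP`, `DZP` (in the form of `norm_evalC_ge_of_tpmem`). [cite: Moore1966, Theorem 3.1] -/
theorem range_bounds (h0 : 0 ≤ h) (hAW : TPMem S h aW AW) (hAZ : TPMem S h aZ AZ)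
    {ρ : ℝ} (hρ : |ρ| ≤ h) {Rn : ℤ} {Rd : ℕ} (hRn : 0 ≤ Rn) (hRd : 0 < Rd) {t : ℂ} (ht : ‖t‖ ≤ (Rn : ℝ) / Rd) :
    ‖candC aW ρ t‖ * S ≤ (absBoundI S Rn Rd (AW.map (tboundI S h)) : ℝ) ∧
    ‖candC aZ ρ t‖ * S ≤ (absBoundI S Rn Rd (AZ.map (tboundI S h)) : ℝ) :=
  ⟨norm_evalC_le_of_tpmem h0 hAW hρ hRn hRd ht, norm_evalC_le_of_tpmem h0 hAZ hρ hRn hRd ht⟩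

/-- Lower bound of `‖D_W(ŷ(t))‖ · S` on the disc from the head and tail of the model list `DWP = P₀ :: Ps`. [folklore] -/
theorem norm_cDW_cand_ge (hS : 0 < S) (h0 : 0 ≤ h) (hAW : TPMem S h aW AW) (hAZ : TPMem S h aZ AZ)
    {P₀ : IPoly} {Ps : TPoly} (hsplit : DWP S h D AW AZ = P₀ :: Ps)
    {ρ : ℝ} (hρ : |ρ| ≤ h) {Rn : ℤ} {Rd : ℕ} (hRn : 0 ≤ Rn) (hRd : 0 < Rd) {t : ℂ} (ht : ‖t‖ ≤ (Rn : ℝ) / Rd) :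
    ((max (tlowerI S h P₀) (-tupperI S h P₀) : ℤ) : ℝ) - (Rn : ℝ) / Rd * (absBoundI S Rn Rd (Ps.map (tboundI S h)) : ℝ)
      ≤ ‖cDW (candC aW ρ t) (candC aZ ρ t)‖ * S := by
  have hmem : TPMem S h (DWfs aW aZ) (P₀ :: Ps) := hsplit ▸ tpmem_DWP (D := D) hS h0 hAW hAZ
  -- destructure the function list along the membership
  generalize hfs : DWfs aW aZ = fs at hmem
  match fs, hmem with
  | f :: fs', List.Forall₂.cons hf hfs' =>
    have h := norm_evalC_ge_of_tpmem h0 hf hfs' hρ hRn hRd ht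
    have e : evalC (evalAt ρ (f :: fs')) t = cDW (candC aW ρ t) (candC aZ ρ t) := by
      rw [← hfs]; exact evalC_DWfs aW aZ ρ t
    rw [e] at h; exact h

/-- Lower bound of `‖D_Z(ŷ(t))‖ · S` on the disc. [folklore] -/
theorem norm_cDZ_cand_ge (hS : 0 < S) (h0 : 0 ≤ h) (hAW : TPMem S h aW AW) (hAZ : TPMem S h aZ AZ)
    {P₀ : IPoly} {Ps : TPoly} (hsplit : DZP S h D AW AZ = P₀ :: Ps)
    {ρ : ℝ} (hρ : |ρ| ≤ h) {Rn : ℤ} {Rd : ℕ} (hRn : 0 ≤ Rn) (hRd : 0 < Rd) {t : ℂ} (ht : ‖t‖ ≤ (Rn : ℝ) / Rd) :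
    ((max (tlowerI S h P₀) (-tupperI S h P₀) : ℤ) : ℝ) - (Rn : ℝ) / Rd * (absBoundI S Rn Rd (Ps.map (tboundI S h)) : ℝ)
      ≤ ‖cDZ (candC aW ρ t) (candC aZ ρ t)‖ * S := by
  have hmem : TPMem S h (DZfs aW aZ) (P₀ :: Ps) := hsplit ▸ tpmem_DZP (D := D) hS h0 hAW hAZ
  generalize hfs : DZfs aW aZ = fs at hmem
  match fs, hmem with
  | f :: fs', List.Forall₂.cons hf hfs' =>
    have h := norm_evalC_ge_of_tpmem h0 hf hfs' hρ hRn hRd ht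
    have e : evalC (evalAt ρ (f :: fs')) t = cDZ (candC aW ρ t) (candC aZ ρ t) := by
      rw [← hfs]; exact evalC_DZfs aW aZ ρ t
    rw [e] at h; exact h

/-- **The defect bound on the disc, uniformly in the parameter** (field form, scale-free): if the kernel certifies
`absBoundI(EWP) ≤ B_W`, `absBoundI(EZP) ≤ B_Z` and the lower bounds `L_W ≤ (max(lo,−hi)(head DWP))·R_d − R_n·absBoundI(tail DWP)`
(same for `Z`) with `L_W, L_Z > 0`, then for `|ρ| ≤ h`, `‖t‖ ≤ R_n/R_d`:
`‖ŷ′(t) − F_{r(ρ)}(ŷ(t))‖ ≤ max(B_W R_d/L_W, B_Z R_d/L_Z)`. [cite: Moore1966, Theorem 3.1] -/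
theorem norm_defect_le (hS : 0 < S) (h0 : 0 ≤ h) (hR : TMem S h rF RM) (hAW : TPMem S h aW AW) (hAZ : TPMem S h aZ AZ)
    {Rn : ℤ} {Rd : ℕ} (hRn : 0 ≤ Rn) (hRd : 0 < Rd) {BW BZ LW LZ : ℤ} (hLW : 0 < LW) (hLZ : 0 < LZ)
    (hBW : absBoundI S Rn Rd ((EWP S h D RM AW AZ).map (tboundI S h)) ≤ BW)
    (hBZ : absBoundI S Rn Rd ((EZP S h D RM AW AZ).map (tboundI S h)) ≤ BZ)
    {PW : IPoly} {PWs : TPoly} (hsW : DWP S h D AW AZ = PW :: PWs)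
    {PZ : IPoly} {PZs : TPoly} (hsZ : DZP S h D AW AZ = PZ :: PZs)
    (hLWle : LW ≤ max (tlowerI S h PW) (-tupperI S h PW) * Rd - Rn * absBoundI S Rn Rd (PWs.map (tboundI S h)))
    (hLZle : LZ ≤ max (tlowerI S h PZ) (-tupperI S h PZ) * Rd - Rn * absBoundI S Rn Rd (PZs.map (tboundI S h)))
    {ρ : ℝ} (hρ : |ρ| ≤ h) {t : ℂ} (ht : ‖t‖ ≤ (Rn : ℝ) / Rd) :
    ‖deriv (fun t => ((candC aW ρ t, candC aZ ρ t) : ℂ × ℂ)) t - cfield (rF ρ) (candC aW ρ t, candC aZ ρ t)‖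
      ≤ max ((BW : ℝ) * Rd / LW) ((BZ : ℝ) * Rd / LZ) := by
  have hRr : (0 : ℝ) < Rd := by exact_mod_cast hRd
  rw [(hasDerivAt_cand aW aZ ρ t).deriv]
  -- the two defect numerators
  have hEW : ‖evalC (evalAt ρ (EWfs rF aW aZ)) t‖ * S ≤ (BW : ℝ) :=
    (norm_evalC_le_of_tpmem h0 (tpmem_EWP (D := D) hS h0 hR hAW hAZ) hρ hRn hRd ht).trans (by exact_mod_cast hBW)
  have hEZ : ‖evalC (evalAt ρ (EZfs rF aW aZ)) t‖ * S ≤ (BZ : ℝ) :=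
    (norm_evalC_le_of_tpmem h0 (tpmem_EZP (D := D) hS h0 hR hAW hAZ) hρ hRn hRd ht).trans (by exact_mod_cast hBZ)
  -- the two denominators
  have hDW : (LW : ℝ) ≤ ‖cDW (candC aW ρ t) (candC aZ ρ t)‖ * S * Rd := by
    have hge := norm_cDW_cand_ge (D := D) hS h0 hAW hAZ hsW hρ hRn hRd ht
    have h' : (LW : ℝ) ≤ (max (tlowerI S h PW) (-tupperI S h PW) : ℝ) * Rd - Rn * (absBoundI S Rn Rd (PWs.map (tboundI S h)) : ℝ) := by
      exact_mod_cast hLWle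
    have h3 : ((max (tlowerI S h PW) (-tupperI S h PW) : ℤ) : ℝ) * Rd - Rn * (absBoundI S Rn Rd (PWs.map (tboundI S h)) : ℝ)
        ≤ ‖cDW (candC aW ρ t) (candC aZ ρ t)‖ * S * Rd := by
      have := mul_le_mul_of_nonneg_right hge hRr.le
      have e : (((max (tlowerI S h PW) (-tupperI S h PW) : ℤ) : ℝ) - (Rn : ℝ) / Rd * (absBoundI S Rn Rd (PWs.map (tboundI S h)) : ℝ)) * Rd
          = ((max (tlowerI S h PW) (-tupperI S h PW) : ℤ) : ℝ) * Rd - Rn * (absBoundI S Rn Rd (PWs.map (tboundI S h)) : ℝ) := by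
        field_simp
      rw [e] at this; exact this
    push_cast at h' h3 ⊢
    linarith
  have hDZ : (LZ : ℝ) ≤ ‖cDZ (candC aW ρ t) (candC aZ ρ t)‖ * S * Rd := by
    have hge := norm_cDZ_cand_ge (D := D) hS h0 hAW hAZ hsZ hρ hRn hRd ht
    have h' : (LZ : ℝ) ≤ (max (tlowerI S h PZ) (-tupperI S h PZ) : ℝ) * Rd - Rn * (absBoundI S Rn Rd (PZs.map (tboundI S h)) : ℝ) := by
      exact_mod_cast hLZle
    have h3 : ((max (tlowerI S h PZ) (-tupperI S h PZ) : ℤ) : ℝ) * Rd - Rn * (absBoundI S Rn Rd (PZs.map (tboundI S h)) : ℝ)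
        ≤ ‖cDZ (candC aW ρ t) (candC aZ ρ t)‖ * S * Rd := by
      have := mul_le_mul_of_nonneg_right hge hRr.le
      have e : (((max (tlowerI S h PZ) (-tupperI S h PZ) : ℤ) : ℝ) - (Rn : ℝ) / Rd * (absBoundI S Rn Rd (PZs.map (tboundI S h)) : ℝ)) * Rd
          = ((max (tlowerI S h PZ) (-tupperI S h PZ) : ℤ) : ℝ) * Rd - Rn * (absBoundI S Rn Rd (PZs.map (tboundI S h)) : ℝ) := by
        field_simp
      rw [e] at this; exact this
    push_cast at h' h3 ⊢
    linarith
  -- componentwise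
  have h1 := norm_sub_div_le (yp := deriv (candC aW ρ) t) hS hRd hLW hEW hDW (evalC_EWfs rF aW aZ ρ t)
  have h2 := norm_sub_div_le (yp := deriv (candC aZ ρ) t) hS hRd hLZ hEZ hDZ (evalC_EZfs rF aW aZ ρ t)
  have e : ((deriv (candC aW ρ) t, deriv (candC aZ ρ) t) : ℂ × ℂ) - cfield (rF ρ) (candC aW ρ t, candC aZ ρ t) =
      (deriv (candC aW ρ) t - cNW (rF ρ) (candC aW ρ t) (candC aZ ρ t) / cDW (candC aW ρ t) (candC aZ ρ t),
       deriv (candC aZ ρ) t - cNZ (rF ρ) (candC aW ρ t) (candC aZ ρ t) / cDZ (candC aW ρ t) (candC aZ ρ t)) := rfl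
  rw [e, Prod.norm_def]
  exact max_le_max h1 h2

end sound

/-! ### Kernel smoke test of the format -/

/-- The composed models reduce in the kernel: a toy candidate `ŷ = (1 + 2t, 1)` at scale `2⁴`, window `|ρ| ≤ 1/4`, `r = 1 + ρ`,
degree `1`, on the disc of radius `1/2` (the numbers mean nothing; the point is that `decide` evaluates `EWP`, `tboundI`,
`absBoundI`). [folklore] -/
theorem kernel_smoke :
    absBoundI 16 1 2 ((EWP 16 (1 / 4) 1 (tvar 16 (ofRat 16 1)) [[MI.ofInt 16 1], [MI.ofInt 16 2]] [[MI.ofInt 16 1]]).map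
      (tboundI 16 (1 / 4))) ≤ 1000 ∧
    absBoundI 16 1 2 ((DZP 16 (1 / 4) 1 [[MI.ofInt 16 1], [MI.ofInt 16 2]] [[MI.ofInt 16 1]]).map (tboundI 16 (1 / 4))) ≤ 1000 := by
  decide +kernel


end ComplexDisc

end Monatomic

end BuckmasterCaolaboraGomezserrano2025

end Literature.Analysis.FluidPDE
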